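import Mathlib
import HarnessLib
import Literature.Computability.AlgebraicComplexity.AsymptoticSubrankDuality
import Summits.MatrixMultiplication.MatrixMultiplication.Theorems.OutsiderSandwichCouplingBenchmark
import Summits.MatrixMultiplication.MatrixMultiplication.Theorems.OutsiderSandwichCouplingSubrankItems

/-!
# OutsiderSandwich — `CouplingSubrankFull` holds: `64 ≤ F(C)`; the g16 layer `ω = 2 ⟺ CouplingIsMM ∧ CouplingMergeOptimal` is unconditional (decomp-mm lens-4, g17)

Closes item 28253 `CouplingSubrankFull` of `Theses/OutsiderSandwich.lean` and removes the
hypothesis `CouplingSubrankFull` from the g16 layer of the node: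

* `couplingSubrankFull_holds` — at every universal spectral point `F` over `ℂ`, `64 ≤ F(C)` for the
  coupling tensor `C = C₁ ⊠ C₂ ⊠ C₃` of `cw₂ ⊗ cw₂`: `F(C) ≥ 4 · F⟨2,2,2⟩²`
  (`OutsiderSandwichCouplingBenchmark.couplingBenchmark_holds`, the Coppersmith–Winograd value of the
  coupled block read on the spectrum) and `F⟨2,2,2⟩ ≥ 4` (flattening / edge rigidity).
* `le_asymptoticSubrank_couplingTensor` — hence **`Q̃(C) ≥ 64`** by Strassen duality for the
  asymptotic subrank (`strassen_duality_asymptoticSubrank_holds`, CVZ Prop. 1.6: the minimum over the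
  asymptotic spectrum is attained).
* `summit_iff_couplingIsMM`, `couplingIsMM_of_summit`, `couplingIsMM_iff_couplingTangency` — the g16
  statements (`OutsiderSandwichCouplingSubrank.summit_iff_couplingIsMM` etc.) with their hypothesis
  `CouplingSubrankFull` discharged: **`ω = 2 ⟺ (⟨8,8,8⟩ ≲ C at every universal point) ∧
  CouplingMergeOptimal`**, and the ω-free leaf `CouplingIsMM` is NECESSARY for the summit outright.
* `couplingSubrankFull_item`, `summit_iff_couplingIsMM_items` — the same over the route declarations
  (item 28253 by name; the conclusion of item 28260 `SummitIffCouplingIsMM` without its hypothesis).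
-/

noncomputable section

namespace Summit.MatrixMultiplication.MatrixMultiplication.Theorems.OutsiderSandwichCouplingSubrankFull

open Literature.Computability.AlgebraicComplexity
open Summit.MatrixMultiplication.MatrixMultiplication.Theorems.OutsiderSandwichCoupling

/-! ## 1. The spectral floor of the coupling tensor -/

/-- **`CouplingSubrankFull` holds**: `64 ≤ F(C)` at every universal spectral point over `ℂ`. -/
theorem couplingSubrankFull_holds : OutsiderSandwichCouplingSubrank.CouplingSubrankFull := by
  intro F hF
  have h4 : (4 : ℝ) ≤ F (matMulTensor ℂ 2 2 2) :=
    OutsiderSandwichEdgeRigidity.four_le_map_matMulTensor_two hF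
  have hB : 4 * F (matMulTensor ℂ 2 2 2) ^ 2 ≤ F couplingTensor :=
    OutsiderSandwichCouplingBenchmark.couplingBenchmark_holds F hF
  nlinarith [h4, hB]

/-- **`Q̃(C) ≥ 64`**: the asymptotic subrank of the coupling tensor is at least `64` (Strassen
duality: some universal spectral point attains `Q̃(C)`). -/
theorem le_asymptoticSubrank_couplingTensor : (64 : ℝ) ≤ asymptoticSubrank ℂ couplingTensor := by
  obtain ⟨F, hF, hFC⟩ := (strassen_duality_asymptoticSubrank_holds ℂ couplingTensor).2
  rw [← hFC]
  exact couplingSubrankFull_holds F hF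

/-! ## 2. The g16 layer, unconditionally -/

/-- **`ω = 2 ⟺ CouplingIsMM ∧ CouplingMergeOptimal`** (g16's refined exact cut, now without the
hypothesis `CouplingSubrankFull`). -/
theorem summit_iff_couplingIsMM :
    _root_.MatrixMultiplication ↔ CouplingIsMM ∧ CouplingMergeOptimal :=
  OutsiderSandwichCouplingSubrank.summit_iff_couplingIsMM couplingSubrankFull_holds

/-- **The ω-free leaf is necessary**: `ω = 2 ⟹ CouplingIsMM` (`⟨8,8,8⟩ ≲ C` at every universal
point), unconditionally. -/
theorem couplingIsMM_of_summit (hS : _root_.MatrixMultiplication) : CouplingIsMM :=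
  OutsiderSandwichCouplingSubrank.couplingIsMM_of_summit couplingSubrankFull_holds hS

/-- Given only the residual, the leaf and the attacked piece coincide:
`CouplingMergeOptimal ⟹ (CouplingIsMM ⟺ CouplingTangency)`. -/
theorem couplingIsMM_iff_couplingTangency (hR : CouplingMergeOptimal) :
    CouplingIsMM ↔ CouplingTangency :=
  OutsiderSandwichCouplingSubrank.couplingIsMM_iff_couplingTangency couplingSubrankFull_holds hR

/-! ## 3. Over the route declarations -/

/-- **Item 28253 `CouplingSubrankFull` of `Theses/OutsiderSandwich.lean`, by name.** -/
theorem couplingSubrankFull_item : Theses.OutsiderSandwich.CouplingSubrankFull :=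
  OutsiderSandwichCouplingSubrankItems.couplingSubrankFull_iff.2 couplingSubrankFull_holds

/-- The conclusion of item 28260 `SummitIffCouplingIsMM` without its hypothesis, over the route
declarations: `ω = 2 ⟺ CouplingIsMM ∧ CouplingMergeOptimal`. -/
theorem summit_iff_couplingIsMM_items :
    _root_.MatrixMultiplication ↔
      (Theses.OutsiderSandwich.CouplingIsMM ∧ Theses.OutsiderSandwich.CouplingMergeOptimal) :=
  OutsiderSandwichCouplingSubrankItems.summitIffCouplingIsMM_holds couplingSubrankFull_item

/-- The conclusion of item 28259 `CouplingIsMMNecessary` without its hypothesis, over the route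
declarations: `ω = 2 ⟹ CouplingIsMM`. -/
theorem couplingIsMM_of_summit_items (hS : _root_.MatrixMultiplication) :
    Theses.OutsiderSandwich.CouplingIsMM :=
  OutsiderSandwichCouplingSubrankItems.couplingIsMMNecessary_holds couplingSubrankFull_item hS

end Summit.MatrixMultiplication.MatrixMultiplication.Theorems.OutsiderSandwichCouplingSubrankFull
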